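import Mathlib

/-!
# LAW-CEILING witness: an open-under-law HIGH alphabet at height 25 200 (transfer lens g11, pen + one kernel evaluation)

Token: line stmt-HodgeConjecture-18881 Cruxes/BlochSeedDiscOne/Lines/birth.lean 814a6a70c14e831a stub_rung_pad4_seedAt.
HC ∕ HC_CM (HELD) ∕ HC_AV ∕ 18881 ∕ H2 NOT proved or touched; width toward H2 = 0. Not a census sentence; no instrument run.

Companion of `LawImpliesII.lean` («(L-rad‴) ⇒ (ii) at every h ≤ 45», proved there by: all 272 open-under-law alphabets of height ≤ 45 are LOW).
THIS FILE shows that the «ALL-LOW» route does NOT extend to all heights: the alphabet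
    A = {1680/6803, 5040/6803, 10080/6803, 25200/6803} = (1680/6803)·{1, 3, 6, 15}     (6803 prime; height 25 200)
is pencil-open, every one of its six classes is law-S by clause (a) (rn ∧ rp: for the shape {1,3,6,15} the twelve numbers a ± b divide
2g = 2·6803·1680·gcd, because 1680 = 2⁴·3·5·7), and it is HIGH: f(A) = e₁+e₂+e₃ − 34(1+e₄) > 0 (≈ +7.0; R ≈ 38.5 ≥ 35).
So `checkLow 25200 = false`, and the HIGH-SET LEMMA alone cannot give «(L-rad‴) ⇒ (ii)» beyond some finite height.
The pen theorem behind it (memo §7v «LAW-CEILING»): integer shapes {n₁<n₂<n₃<n₄} scaled by γ/δ (γ a multiple of the shape's lcm, δ a large prime)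
are open under the law at every scale, their moment vectors are dense near the flat target (16,36,16,1) = e(u*) (u* = the roots of
t⁴ − 16t³ + 36t² − 16t + 1, i.e. t + 1/t = 8 ± √30), hence for all large H the open-under-law alphabets of height ≤ H carry a positively
weighted FLAT family: the implication «law ⇒ (ii)» has a TRUE CEILING in H. (The explicit flat family is not exhibited here.)
-/

namespace Summit.HodgeConjecture.HodgeConjecture.Cruxes.BlochSeedDiscOne.TransferLawCeiling

/-! ## The pencil model: letters, pair data, resonance, the law -/

/-- height of a rational letter `p/q` in lowest terms: `max p q`. -/
def height (x : ℚ) : ℕ := max x.num.natAbs x.den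

/-- a letter of height ≤ H: a positive rational ≠ 1. -/
def IsLetter (H : ℕ) (x : ℚ) : Prop := 0 < x ∧ x ≠ 1 ∧ height x ≤ H

/-- reduced data of a pair of letters. -/
structure PairData where
  g : ℕ
  P : ℕ
  Q : ℕ
  P' : ℕ
  Q' : ℕ
  deriving DecidableEq, Repr

/-- `g = gcd(p,p′)·gcd(q,q′)` and the letters reduced by the two gcds. -/
def pairData (x y : ℚ) : PairData :=
  let p := x.num.natAbs
  let q := x.den
  let p' := y.num.natAbs
  let q' := y.den
  let gN := Nat.gcd p p'
  let gD := Nat.gcd q q'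
  { g := gN * gD, P := p / gN, Q := q / gD, P' := p' / gN, Q' := q' / gD }

namespace PairData

def a (d : PairData) : ℕ := d.P * d.Q'
def b (d : PairData) : ℕ := d.P' * d.Q
/-- `n = |a - b|` -/
def n (d : PairData) : ℕ := max d.a d.b - min d.a d.b
/-- `n₊ = a + b` -/
def npl (d : PairData) : ℕ := d.a + d.b
/-- `N = a² + b²` -/
def N (d : PairData) : ℕ := d.a ^ 2 + d.b ^ 2
def M (d : PairData) : ℕ := d.P * d.Q * d.P' * d.Q'
/-- `M* = 2M` if `M` is even, `M` if odd. -/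
def Ms (d : PairData) : ℕ := if d.M % 2 = 0 then 2 * d.M else d.M
/-- tag `n`: `n > 0 ∧ n ∣ 2g` -/
def rn (d : PairData) : Bool := decide (0 < d.n) && decide (2 * d.g % d.n = 0)
/-- tag `n₊`: `n₊ ∣ 2g` -/
def rp (d : PairData) : Bool := decide (2 * d.g % d.npl = 0)
/-- tag `d`: `N ∣ 2ga ∧ N ∣ 2gb` -/
def rd (d : PairData) : Bool := decide (2 * d.g * d.a % d.N = 0) && decide (2 * d.g * d.b % d.N = 0)
/-- pencil resonance (scope S9–S13): `g > 1` and one of the three tags. -/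
def resonant (d : PairData) : Bool := decide (1 < d.g) && (d.rn || d.rp || d.rd)
/-- the EMPIRICAL law (L-rad‴): `true` = predicted SILENT, `false` = predicted KILL. -/
def lawS (d : PairData) : Bool :=
  if !(d.rn || d.rp || d.rd) then false
  else if d.rn && d.rp then true
  else if d.rd then (decide (0 < d.n) && decide (d.g % d.n = 0)) || decide (d.g % d.Ms = 0)
  else decide (d.g % d.Ms = 0)

end PairData

/-- a pair of letters stays OPEN under the law hypothesis: inverse pair (no class), or resonant with law verdict SILENT. -/
def openPair (x y : ℚ) : Bool :=
  decide (x * y = 1) || ((pairData x y).resonant && (pairData x y).lawS)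

/-! ## Moments and the high-set functional -/

def e₁ (x y z w : ℚ) : ℚ := x^2 + y^2 + z^2 + w^2
def e₂ (x y z w : ℚ) : ℚ := x^2*y^2 + x^2*z^2 + x^2*w^2 + y^2*z^2 + y^2*w^2 + z^2*w^2
def e₃ (x y z w : ℚ) : ℚ := x^2*y^2*z^2 + x^2*y^2*w^2 + x^2*z^2*w^2 + y^2*z^2*w^2
def e₄ (x y z w : ℚ) : ℚ := x^2*y^2*z^2*w^2
/-- the HIGH-SET functional `f = e₁+e₂+e₃ − 34(1+e₄)`; an alphabet is LOW iff `f < 0` (i.e. `R < 35`). -/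
def fHigh (x y z w : ℚ) : ℚ := e₁ x y z w + e₂ x y z w + e₃ x y z w - 34 * (1 + e₄ x y z w)

/-! ## The witness -/

def A₁ : ℚ := 1680 / 6803
def A₂ : ℚ := 5040 / 6803
def A₃ : ℚ := 10080 / 6803
def A₄ : ℚ := 25200 / 6803

/-- 6803 is prime (so the four letters are in lowest terms with denominator 6803; height = 25 200). -/
theorem prime_6803 : Nat.Prime 6803 := by norm_num
theorem A_heights : height A₁ = 6803 ∧ height A₂ = 6803 ∧ height A₃ = 10080 ∧ height A₄ = 25200 := by native_decide
theorem A_ordered : A₁ < A₂ ∧ A₂ < A₃ ∧ A₃ < A₄ := by norm_num [A₁, A₂, A₃, A₄]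
/-- all six classes of A are pencil-resonant AND law-S (clause (a): tags rn ∧ rp), i.e. OPEN under the law hypothesis. -/
theorem A_open : openPair A₁ A₂ = true ∧ openPair A₁ A₃ = true ∧ openPair A₁ A₄ = true ∧
    openPair A₂ A₃ = true ∧ openPair A₂ A₄ = true ∧ openPair A₃ A₄ = true := by native_decide
theorem A_clause_a : ((pairData A₁ A₂).rn && (pairData A₁ A₂).rp) = true ∧ ((pairData A₁ A₃).rn && (pairData A₁ A₃).rp) = true ∧
    ((pairData A₁ A₄).rn && (pairData A₁ A₄).rp) = true ∧ ((pairData A₂ A₃).rn && (pairData A₂ A₃).rp) = true ∧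
    ((pairData A₂ A₄).rn && (pairData A₂ A₄).rp) = true ∧ ((pairData A₃ A₄).rn && (pairData A₃ A₄).rp) = true := by native_decide
/-- the pair data of the class {A₁, A₄; 0}: g = 1680·6803, reduced letters 1/1 and 15/1 (a = 1, b = 15, n = 14, n₊ = 16). -/
theorem A14_data : pairData A₁ A₄ = { g := 1680 * 6803, P := 1, Q := 1, P' := 15, Q' := 1 } := by native_decide
/-- A is HIGH: f(A) > 0 (so `R(A) ≥ 35`); hence not every open-under-law alphabet is low. -/
theorem A_high : 0 < fHigh A₁ A₂ A₃ A₄ := by norm_num [fHigh, e₁, e₂, e₃, e₄, A₁, A₂, A₃, A₄]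
/-- the same as a Boolean evaluation (cross-check of `A_high` by the compiler). -/
theorem A_high' : decide (0 < fHigh A₁ A₂ A₃ A₄) = true := by native_decide

/-- an abstract open-under-law alphabet (as in `LawImpliesII.lean`). -/
def OpenUnderLaw (H : ℕ) (x y z w : ℚ) : Prop :=
  IsLetter H x ∧ IsLetter H y ∧ IsLetter H z ∧ IsLetter H w ∧ x < y ∧ y < z ∧ z < w ∧
  openPair x y = true ∧ openPair x z = true ∧ openPair x w = true ∧
  openPair y z = true ∧ openPair y w = true ∧ openPair z w = true

/-- LAW-CEILING WITNESS: at height 25 200 there is an open-under-law alphabet that is NOT low. -/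
theorem exists_open_high_25200 : ∃ x y z w : ℚ, OpenUnderLaw 25200 x y z w ∧ 0 < fHigh x y z w := by
  obtain ⟨h1, h2, h3, h4⟩ := A_heights
  obtain ⟨o1, o2, o3, o4, o5, o6⟩ := A_open
  refine ⟨A₁, A₂, A₃, A₄, ⟨⟨by norm_num [A₁], by norm_num [A₁], by omega⟩, ⟨by norm_num [A₂], by norm_num [A₂], by omega⟩,
    ⟨by norm_num [A₃], by norm_num [A₃], by omega⟩, ⟨by norm_num [A₄], by norm_num [A₄], by omega⟩,
    A_ordered.1, A_ordered.2.1, A_ordered.2.2, o1, o2, o3, o4, o5, o6⟩, A_high⟩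

end Summit.HodgeConjecture.HodgeConjecture.Cruxes.BlochSeedDiscOne.TransferLawCeiling
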